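/-
Copyright: harness tree, Literature layer (sorry-free). b2b-lace num3-g12 (CERTIFIED NUMERICS SEAT 3 / ENUMERATION-HEAVY
LANE gen 12).  KERNEL form of the `F-IM` threshold tables of the `d = 11` record: the twelve displayed table hypotheses
`hU20 … hL35` of `MeanFieldD11InitTables` / `MeanFieldD11AppDDischargedRev7` become THEOREMS under the single displayed
seed binder `SeedBallsY` of `MeanFieldD11FimTabsI` (PROVED in `MeanFieldD11FimSeedBalls`); this file is the EVALUATOR
and its soundness, `MeanFieldD11FimDischarged` runs it on the six cells.  Additive module: no record file is touched.
No `sorry`.  GENERATED (key tables) by `run/shared/lean/b2b/lace/code/num3/g12/gen_fim_tables.py`.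
-/
import Literature.Probability.FitznerVanDerHofstad2017.MeanFieldD11FimTabsI
import Literature.Probability.FitznerVanDerHofstad2017.SrwIntegralJTables
import Literature.Probability.FitznerVanDerHofstad2017.SrwIntegralJStep
import HarnessLib

/-!
# The F-IM tables of the `d = 11` record, decided by the kernel

`MeanFieldD11FimSup` tabulates, for the six record cells `(m,l) ∈ {(2,0),(3,0),(3,1),(3,2),(3,3),(3,5)}`, thresholds
`U_<cell> p` (upper, at every partition `p` of `r ≤ 7`) and `Lo_<cell> p` (lower, at the listed `nodes_<cell>`) for
the SRW quantity `𝓙_{m−2,l}(p̂) = srwJ 11 m l (vecOfParts 11 p)` ((1.6.9)/(3.30) of [NoBLE17-I]; at `r = 7` for its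
cone majorant `srwJcone`), and `MeanFieldD11InitTables.nobleWeightedDiagramBoundAt_bi7` consumes them as the twelve
HYPOTHESES `JUpper 11 m l 1 6 U_<cell>` / `JLower 11 m l Lo_<cell> nodes_<cell>` — "numerical facts about SRW
integrals, dischargeable by certified engines" (GAPS (S2b-INIT tables)).  This file discharges them IN THE KERNEL:

* §A  class keys: `absKey z` (the sorted moduli of `z ∈ ℤ¹¹`); `absKey z = absKey z' ⇒ I_{n,l}(z) = I_{n,l}(z')`
  (hyper-octahedral invariance `srwI_spAct` via `exists_spAct_eq_of_card_abs_eq`); literal keys of the 18 + 9 + 36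
  tabulated classes `V`/`X`/`Y`, decided equal to the keys of their representatives.
* §B  tier-1 enclosures `enc1 n l z` — served `tabsLo.I/tabsHi.I` at the `V` classes (valid: `tabsI_valid`), the
  decided caches `fxLo/fxHi` (`X`, `l ≤ 7`, valid: `fx_valid`) and `fyLo/fyHi` (`Y`, `l ≤ 6`, valid under `hBY`:
  `fy_valid`) of `MeanFieldD11FimTabsI` — and their soundness `enc1_sound`.
* §C  tier-2 enclosures `encF fuel n l z`: where no table applies — the DERIVED classes `Z = {7, 7 1, 8}` (reached as
  `6̂ + 2e₀ = 8̂`, `(5,1)^ + 2e₀ = (7,1)^` and at the cone row `7̂`; their SEEDCERT certificates exceed the kernel budget)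
  — the EXACT one-step identity `I_{n,l+1}(y) = (2d)⁻¹ Σ_e I_{n,l}(y − e)` (`srwI_succ_eq_stepAvg`, [NoBLE17-I,
  (3.34)–(3.35)]) solved for the neighbour `z = y + e₀`: `I_{n,l}(z) = 22·I_{n,l+1}(z − e₀) − Σ_{e ≠ −e₀} I_{n,l}(z − e₀ − e)`
  (`stepEnc`, interval arithmetic), evaluated at the literal representative `Z.pt c` of the class of `z` (so that the
  kernel shares the sub-evaluations), recursively (fuel `2`: `8̂ ← 7̂, (7,1)^ ← tables`); soundness `encF_sound`.
* §D  the rational evaluators `jUp/jLo m l z` of `srwJ 11 m l z` and `coneUp m l w` of `srwJcone 11 m l w` (term by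
  term on the definitions `srwJ_def` / `srwJcone`), with definedness predicates `okJ/okC` and soundness
  `srwJ_le_jUp`, `jLo_le_srwJ`, `srwJcone_le_coneUp`.
* §E  the decidable mirrors `JUpperQ m l s R T` / `JLowerQ m l L nodes` of `JUpper 11 m l s R T` / `JLower 11 m l L nodes`
  and the bridges `jUpper_of_Q`, `jLower_of_Q`.
* (§F, in `MeanFieldD11FimDischarged`)  the twelve table hypotheses as theorems: `jUpperQ_<cell>` / `jLowerQ_<cell>`
  by `decide +kernel` and the bridges; the record's initial ball `bi7` (S2b) hypothesis-free.

Precision budget (checked in exact arithmetic before emission by `code/num3/g12/fim_eval.py`, the Python mirror of this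
evaluator): over the 298 rows of the six cells the worst relative slack `(U − jUp)/U` resp. `(jLo − Lo)/Lo` is `6.5e-9`
(cell `(3,2)`, row `3 2`) — the thresholds are engine B's 6-significant-digit outward roundings — against enclosure
widths `≤ 1e-18` relative (tier 2: `≤ 5.2e-19` absolute at `8`, `n = 4`).

## References
* [NoBLE17-I] R. Fitzner, R. van der Hofstad, PTRF 169 (2017) 1041–1119; arXiv:1506.07969 — (1.6.9) p. 1058, §2.1
  p. 1049, (3.30) p. 1070, (3.34)–(3.35) p. 1071, (5.1) p. 1090; notebook `SRW.nb` (arXiv:1506.07977 anc).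
-/

set_option Elab.async false

namespace Literature.Probability.FitznerVanDerHofstad2017

namespace Stage1Cells

namespace CertD11

open Finset SrwCount Literature.Probability.LatticeModels
open scoped BigOperators

/-! ### A. Class keys -/

/-- The class key of `z ∈ ℤ¹¹`: its moduli, sorted non-increasingly. [folklore] -/
def absKey (z : Fin 11 → ℤ) : List ℤ :=
  List.insertionSort (fun a b : ℤ => b ≤ a) (List.ofFn fun i : Fin 11 => |z i|)

/-- The key, as a multiset, is the modulus profile `absProf z`. [folklore] -/
theorem absKey_coe (z : Fin 11 → ℤ) : ((absKey z : List ℤ) : Multiset ℤ) = absProf z := by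
  unfold absKey absProf
  rw [Multiset.coe_eq_coe.mpr (List.perm_insertionSort _ _)]
  exact (Fin.univ_val_map _).symm

/-- **Equal keys, equal integrals**: `absKey z = absKey z' ⇒ I_{n,l}(z; 11) = I_{n,l}(z'; 11)` (a signed permutation
maps `z'` to `z`; `srwI_spAct`). [cite: FitznerVanDerHofstad2016NoBLE, Rem. 5.1 p. 1090] -/
theorem srwI_eq_of_absKey_eq {z z' : Fin 11 → ℤ} (h : absKey z = absKey z') (n l : ℕ) :
    srwI 11 n l z = srwI 11 n l z' := by
  have hp : absProf z' = absProf z := by rw [← absKey_coe, ← absKey_coe, h]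
  obtain ⟨τ, hτ⟩ := exists_spAct_eq_of_card_abs_eq z' z (card_abs_eq_of_absProf_eq hp)
  rw [← hτ, srwI_spAct]

/-- Literal keys of the `V` classes. [folklore] -/
def kV : V → List ℤ
  | .v0 => [0, 0, 0, 0, 0, 0, 0, 0, 0, 0, 0]
  | .v1 => [1, 0, 0, 0, 0, 0, 0, 0, 0, 0, 0]
  | .v2 => [1, 1, 0, 0, 0, 0, 0, 0, 0, 0, 0]
  | .v3 => [1, 1, 1, 0, 0, 0, 0, 0, 0, 0, 0]
  | .v4 => [1, 1, 1, 1, 0, 0, 0, 0, 0, 0, 0]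
  | .v5 => [1, 1, 1, 1, 1, 0, 0, 0, 0, 0, 0]
  | .v01 => [2, 0, 0, 0, 0, 0, 0, 0, 0, 0, 0]
  | .v11 => [2, 1, 0, 0, 0, 0, 0, 0, 0, 0, 0]
  | .v001 => [3, 0, 0, 0, 0, 0, 0, 0, 0, 0, 0]
  | .v02 => [2, 2, 0, 0, 0, 0, 0, 0, 0, 0, 0]
  | .v12 => [2, 2, 1, 0, 0, 0, 0, 0, 0, 0, 0]
  | .v21 => [2, 1, 1, 0, 0, 0, 0, 0, 0, 0, 0]
  | .v31 => [2, 1, 1, 1, 0, 0, 0, 0, 0, 0, 0]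
  | .v101 => [3, 1, 0, 0, 0, 0, 0, 0, 0, 0, 0]
  | .v011 => [3, 2, 0, 0, 0, 0, 0, 0, 0, 0, 0]
  | .v201 => [3, 1, 1, 0, 0, 0, 0, 0, 0, 0, 0]
  | .v0001 => [4, 0, 0, 0, 0, 0, 0, 0, 0, 0, 0]
  | .v1001 => [4, 1, 0, 0, 0, 0, 0, 0, 0, 0, 0]
  | .v00001 => [5, 0, 0, 0, 0, 0, 0, 0, 0, 0, 0]

/-- Literal keys of the `X` classes. [folklore] -/
def kX : X → List ℤ
  | .x6 => [1, 1, 1, 1, 1, 1, 0, 0, 0, 0, 0]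
  | .x41 => [2, 1, 1, 1, 1, 0, 0, 0, 0, 0, 0]
  | .x22 => [2, 2, 1, 1, 0, 0, 0, 0, 0, 0, 0]
  | .x03 => [2, 2, 2, 0, 0, 0, 0, 0, 0, 0, 0]
  | .x002 => [3, 3, 0, 0, 0, 0, 0, 0, 0, 0, 0]
  | .x111 => [3, 2, 1, 0, 0, 0, 0, 0, 0, 0, 0]
  | .x0101 => [4, 2, 0, 0, 0, 0, 0, 0, 0, 0, 0]
  | .x2001 => [4, 1, 1, 0, 0, 0, 0, 0, 0, 0, 0]
  | .x000001 => [6, 0, 0, 0, 0, 0, 0, 0, 0, 0, 0]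

/-- Literal keys of the `Y` classes. [folklore] -/
def kY : Y → List ℤ
  | .y5 => [1, 1, 1, 1, 1, 0, 0, 0, 0, 0, 0]
  | .y10001 => [5, 1, 0, 0, 0, 0, 0, 0, 0, 0, 0]
  | .y301 => [3, 1, 1, 1, 0, 0, 0, 0, 0, 0, 0]
  | .y100001 => [6, 1, 0, 0, 0, 0, 0, 0, 0, 0, 0]
  | .y01001 => [5, 2, 0, 0, 0, 0, 0, 0, 0, 0, 0]
  | .y20001 => [5, 1, 1, 0, 0, 0, 0, 0, 0, 0, 0]
  | .y0011 => [4, 3, 0, 0, 0, 0, 0, 0, 0, 0, 0]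
  | .y1101 => [4, 2, 1, 0, 0, 0, 0, 0, 0, 0, 0]
  | .y3001 => [4, 1, 1, 1, 0, 0, 0, 0, 0, 0, 0]
  | .y102 => [3, 3, 1, 0, 0, 0, 0, 0, 0, 0, 0]
  | .y021 => [3, 2, 2, 0, 0, 0, 0, 0, 0, 0, 0]
  | .y211 => [3, 2, 1, 1, 0, 0, 0, 0, 0, 0, 0]
  | .y401 => [3, 1, 1, 1, 1, 0, 0, 0, 0, 0, 0]
  | .y13 => [2, 2, 2, 1, 0, 0, 0, 0, 0, 0, 0]
  | .y32 => [2, 2, 1, 1, 1, 0, 0, 0, 0, 0, 0]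
  | .y51 => [2, 1, 1, 1, 1, 1, 0, 0, 0, 0, 0]
  | .y7 => [1, 1, 1, 1, 1, 1, 1, 0, 0, 0, 0]
  | .y010001 => [6, 2, 0, 0, 0, 0, 0, 0, 0, 0, 0]
  | .y200001 => [6, 1, 1, 0, 0, 0, 0, 0, 0, 0, 0]
  | .y00101 => [5, 3, 0, 0, 0, 0, 0, 0, 0, 0, 0]
  | .y11001 => [5, 2, 1, 0, 0, 0, 0, 0, 0, 0, 0]
  | .y30001 => [5, 1, 1, 1, 0, 0, 0, 0, 0, 0, 0]
  | .y0002 => [4, 4, 0, 0, 0, 0, 0, 0, 0, 0, 0]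
  | .y1011 => [4, 3, 1, 0, 0, 0, 0, 0, 0, 0, 0]
  | .y0201 => [4, 2, 2, 0, 0, 0, 0, 0, 0, 0, 0]
  | .y2101 => [4, 2, 1, 1, 0, 0, 0, 0, 0, 0, 0]
  | .y4001 => [4, 1, 1, 1, 1, 0, 0, 0, 0, 0, 0]
  | .y012 => [3, 3, 2, 0, 0, 0, 0, 0, 0, 0, 0]
  | .y202 => [3, 3, 1, 1, 0, 0, 0, 0, 0, 0, 0]
  | .y121 => [3, 2, 2, 1, 0, 0, 0, 0, 0, 0, 0]
  | .y311 => [3, 2, 1, 1, 1, 0, 0, 0, 0, 0, 0]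
  | .y501 => [3, 1, 1, 1, 1, 1, 0, 0, 0, 0, 0]
  | .y04 => [2, 2, 2, 2, 0, 0, 0, 0, 0, 0, 0]
  | .y23 => [2, 2, 2, 1, 1, 0, 0, 0, 0, 0, 0]
  | .y42 => [2, 2, 1, 1, 1, 1, 0, 0, 0, 0, 0]
  | .y61 => [2, 1, 1, 1, 1, 1, 1, 0, 0, 0, 0]

/-- The literal `V` keys are the keys of the representatives (kernel decision). [folklore] -/
theorem kV_eq : ∀ v ∈ classesI, kV v = absKey (V.pt 11 v) := by decide +kernel

/-- The literal `X` keys are the keys of the representatives (kernel decision). [folklore] -/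
theorem kX_eq : ∀ e ∈ classesX, kX e = absKey (X.pt e) := by decide +kernel

/-- The literal `Y` keys are the keys of the representatives (kernel decision). [folklore] -/
theorem kY_eq : ∀ e ∈ classesY, kY e = absKey (Y.pt e) := by decide +kernel

/-- The tabulated `V` class with key `k`, if any. [folklore] -/
def matchV (k : List ℤ) : Option V := classesI.find? fun v => decide (kV v = k)

/-- The tabulated `X` class with key `k`, if any. [folklore] -/
def matchX (k : List ℤ) : Option X := classesX.find? fun e => decide (kX e = k)

/-- The tabulated `Y` class with key `k`, if any. [folklore] -/
def matchY (k : List ℤ) : Option Y := classesY.find? fun e => decide (kY e = k)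

/-- `matchV` returns a listed class with the given key. [folklore] -/
theorem matchV_spec {k : List ℤ} {v : V} (h : matchV k = some v) : v ∈ classesI ∧ kV v = k := by
  unfold matchV at h
  have h1 := List.find?_some h
  simp only [decide_eq_true_eq] at h1
  exact ⟨List.mem_of_find?_eq_some h, h1⟩

/-- `matchX` returns a listed class with the given key. [folklore] -/
theorem matchX_spec {k : List ℤ} {e : X} (h : matchX k = some e) : e ∈ classesX ∧ kX e = k := by
  unfold matchX at h
  have h1 := List.find?_some h
  simp only [decide_eq_true_eq] at h1
  exact ⟨List.mem_of_find?_eq_some h, h1⟩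

/-- `matchY` returns a listed class with the given key. [folklore] -/
theorem matchY_spec {k : List ℤ} {e : Y} (h : matchY k = some e) : e ∈ classesY ∧ kY e = k := by
  unfold matchY at h
  have h1 := List.find?_some h
  simp only [decide_eq_true_eq] at h1
  exact ⟨List.mem_of_find?_eq_some h, h1⟩

/-! ### B. Tier-1 enclosures -/

/-- Tier-1 enclosure `[lo, hi] ∋ I_{n,l}(z; 11)` from the tables at the class of `z` (`none` if untabulated).
[cite: FitznerVanDerHofstad2016NoBLE, (5.1) p. 1090] -/
def enc1 (n l : ℕ) (z : Fin 11 → ℤ) : Option (ℚ × ℚ) :=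
  match matchV (absKey z) with
  | some v => some (tabsLo.I n l v, tabsHi.I n l v)
  | none =>
    match matchX (absKey z) with
    | some e => if l ≤ 7 then some (fxLo n l e, fxHi n l e) else none
    | none =>
      match matchY (absKey z) with
      | some e => if l ≤ 6 then some (fyLo n l e, fyHi n l e) else none
      | none => none

/-- **Tier-1 soundness** (`n = 2..4`, `l ≤ 28`). [cite: FitznerVanDerHofstad2016NoBLE, (5.1) p. 1090] -/
theorem enc1_sound (hBY : SeedBallsY) {n l : ℕ} {z : Fin 11 → ℤ} {p : ℚ × ℚ} (hn2 : 2 ≤ n) (hn : n ≤ 4)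
    (hl : l ≤ 28) (h : enc1 n l z = some p) :
    ((p.1 : ℚ) : ℝ) ≤ srwI 11 n l z ∧ srwI 11 n l z ≤ ((p.2 : ℚ) : ℝ) := by
  unfold enc1 at h
  cases hV : matchV (absKey z) with
  | some v =>
    simp only [hV, Option.some.injEq] at h
    subst h
    obtain ⟨hm, hk⟩ := matchV_spec hV
    rw [srwI_eq_of_absKey_eq (show absKey z = absKey (V.pt 11 v) by rw [← hk]; exact kV_eq v hm)]
    exact tabsI_valid v hm n hn l hl
  | none =>
    simp only [hV] at h
    cases hX : matchX (absKey z) with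
    | some e =>
      simp only [hX] at h
      by_cases h7 : l ≤ 7
      · rw [if_pos h7, Option.some.injEq] at h
        subst h
        obtain ⟨hm, hk⟩ := matchX_spec hX
        rw [srwI_eq_of_absKey_eq (show absKey z = absKey (X.pt e) by rw [← hk]; exact kX_eq e hm)]
        exact fx_valid e hm n hn hn2 l h7
      · rw [if_neg h7] at h
        exact absurd h (by simp)
    | none =>
      simp only [hX] at h
      cases hY : matchY (absKey z) with
      | some e =>
        simp only [hY] at h
        by_cases h6 : l ≤ 6
        · rw [if_pos h6, Option.some.injEq] at h
          subst h
          obtain ⟨hm, hk⟩ := matchY_spec hY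
          rw [srwI_eq_of_absKey_eq (show absKey z = absKey (Y.pt e) by rw [← hk]; exact kY_eq e hm)]
          exact fy_valid hBY e hm n hn hn2 l h6
        · rw [if_neg h6] at h
          exact absurd h (by simp)
      | none =>
        simp only [hY] at h
        exact absurd h (by simp)

/-! ### C. Tier-2 enclosures: the one-step identity solved for a neighbour -/

/-- Lower endpoint of an optional enclosure (`0` if absent). [folklore] -/
def loOf (o : Option (ℚ × ℚ)) : ℚ := (o.getD (0, 0)).1

/-- Upper endpoint of an optional enclosure (`0` if absent). [folklore] -/
def hiOf (o : Option (ℚ × ℚ)) : ℚ := (o.getD (0, 0)).2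

/-- The direction `w₀ = (0, false)`, `stepVec w₀ = −e₀`. [folklore] -/
def w0 : SRW.Dir 11 := ((0 : Fin 11), false)

/-- The 21 directions other than `w₀`, as a list. [folklore] -/
def dirsRest : List (SRW.Dir 11) :=
  [((0 : Fin 11), true),
   ((1 : Fin 11), true), ((1 : Fin 11), false), ((2 : Fin 11), true), ((2 : Fin 11), false),
   ((3 : Fin 11), true), ((3 : Fin 11), false), ((4 : Fin 11), true), ((4 : Fin 11), false),
   ((5 : Fin 11), true), ((5 : Fin 11), false), ((6 : Fin 11), true), ((6 : Fin 11), false),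
   ((7 : Fin 11), true), ((7 : Fin 11), false), ((8 : Fin 11), true), ((8 : Fin 11), false),
   ((9 : Fin 11), true), ((9 : Fin 11), false), ((10 : Fin 11), true), ((10 : Fin 11), false)]

/-- `dirsRest` has no duplicates. [folklore] -/
theorem dirsRest_nodup : dirsRest.Nodup := by decide

/-- `dirsRest` lists exactly the directions `≠ w₀`. [folklore] -/
theorem dirsRest_toFinset : dirsRest.toFinset = Finset.univ.erase w0 := by decide

/-- List sum over `dirsRest` = the finset sum over `w ≠ w₀`. [folklore] -/
theorem sum_dirsRest (g : SRW.Dir 11 → ℚ) : (dirsRest.map g).sum = ∑ w ∈ Finset.univ.erase w0, g w := by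
  rw [← dirsRest_toFinset, List.sum_toFinset _ dirsRest_nodup]

/-- The eleven coordinate indices, as a list. [folklore] -/
def fin11 : List (Fin 11) := [0, 1, 2, 3, 4, 5, 6, 7, 8, 9, 10]

/-- `fin11` has no duplicates. [folklore] -/
theorem fin11_nodup : fin11.Nodup := by decide

/-- `fin11` lists every index. [folklore] -/
theorem fin11_toFinset : fin11.toFinset = Finset.univ := by decide

/-- List sum over `fin11` = the sum over `Fin 11`. [folklore] -/
theorem sum_fin11 (g : Fin 11 → ℚ) : (fin11.map g).sum = ∑ i, g i := by
  rw [← fin11_toFinset, List.sum_toFinset _ fin11_nodup]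

/-- The unit vector `e₀`. [folklore] -/
def e0 : Fin 11 → ℤ := axisVec 0 1

/-- `(z − e₀) − stepVec w₀ = z`. [folklore] -/
theorem sub_e0_sub_stepVec_w0 (z : Fin 11 → ℤ) : z - e0 - SRW.stepVec w0 = z := by
  funext i
  simp only [Pi.sub_apply, e0, axisVec, w0, SRW.stepVec_apply]
  split_ifs <;> simp_all

/-- The DERIVED classes (no table): `7`, `7 1`, `8` — points at which (1.6.9) is needed beyond the tables. [cite: FitznerVanDerHofstad2016NoBLE, (1.6.9) p. 1058] -/
inductive Z
  | z7 | z71 | z8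
  deriving DecidableEq, Repr

/-- Literal representatives of the derived classes. [cite: FitznerVanDerHofstad2016NoBLE, (1.6.9) p. 1058] -/
def Z.pt : Z → (Fin 11 → ℤ)
  | .z7 => fun k => ([7] : List ℤ).getD k 0
  | .z71 => fun k => ([7, 1] : List ℤ).getD k 0
  | .z8 => fun k => ([8] : List ℤ).getD k 0

/-- Literal keys of the derived classes. [folklore] -/
def kZ : Z → List ℤ
  | .z7 => [7, 0, 0, 0, 0, 0, 0, 0, 0, 0, 0]
  | .z71 => [7, 1, 0, 0, 0, 0, 0, 0, 0, 0, 0]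
  | .z8 => [8, 0, 0, 0, 0, 0, 0, 0, 0, 0, 0]

/-- The derived classes, as a list. [folklore] -/
def classesZ : List Z := [.z7, .z71, .z8]

/-- The literal `Z` keys are the keys of the representatives (kernel decision). [folklore] -/
theorem kZ_eq : ∀ c ∈ classesZ, kZ c = absKey (Z.pt c) := by decide +kernel

/-- The derived class with key `k`, if any. [folklore] -/
def matchZ (k : List ℤ) : Option Z := classesZ.find? fun c => decide (kZ c = k)

/-- `matchZ` returns a listed class with the given key. [folklore] -/
theorem matchZ_spec {k : List ℤ} {c : Z} (h : matchZ k = some c) : c ∈ classesZ ∧ kZ c = k := by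
  unfold matchZ at h
  have h1 := List.find?_some h
  simp only [decide_eq_true_eq] at h1
  exact ⟨List.mem_of_find?_eq_some h, h1⟩

/-- **One-step enclosure** of `I_{n,l}(z; 11)` from enclosures `look` of `I_{n,l+1}(z − e₀)` and of the 21 values
`I_{n,l}(z − e₀ − stepVec w)`, `w ≠ w₀`, by the identity `I_{n,l}(z) = 22·I_{n,l+1}(z − e₀) − Σ_{w ≠ w₀} I_{n,l}(z − e₀ − stepVec w)`
in interval arithmetic (`none` unless all 22 enclosures are defined). [cite: FitznerVanDerHofstad2016NoBLE, (3.34)–(3.35) p. 1071] -/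
def stepEnc (look : ℕ → ℕ → (Fin 11 → ℤ) → Option (ℚ × ℚ)) (n l : ℕ) (z : Fin 11 → ℤ) : Option (ℚ × ℚ) :=
  if (look n (l + 1) (z - e0)).isSome = true ∧ ∀ w ∈ dirsRest, (look n l (z - e0 - SRW.stepVec w)).isSome = true then
    some (22 * loOf (look n (l + 1) (z - e0)) - (dirsRest.map fun w => hiOf (look n l (z - e0 - SRW.stepVec w))).sum,
          22 * hiOf (look n (l + 1) (z - e0)) - (dirsRest.map fun w => loOf (look n l (z - e0 - SRW.stepVec w))).sum)
  else none

/-- The one-step identity solved for the neighbour `z = (z − e₀) − stepVec w₀`: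
`I_{n,l}(z) = 22·I_{n,l+1}(z − e₀) − Σ_{w ≠ w₀} I_{n,l}(z − e₀ − stepVec w)` (`2n + 1 ≤ 11`).
[cite: FitznerVanDerHofstad2016NoBLE, (3.34)–(3.35) p. 1071] -/
theorem srwI_eq_oneStep {n : ℕ} (hn : n ≤ 4) (l : ℕ) (z : Fin 11 → ℤ) :
    srwI 11 n l z = 22 * srwI 11 n (l + 1) (z - e0)
      - ∑ w ∈ Finset.univ.erase w0, srwI 11 n l (z - e0 - SRW.stepVec w) := by
  have h1 := srwI_succ_eq_stepAvg (d := 11) (n := n) (by omega) l (z - e0)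
  rw [stepAvg] at h1
  have h2 := Finset.add_sum_erase (Finset.univ) (fun w => srwI 11 n l (z - e0 - SRW.stepVec w)) (Finset.mem_univ w0)
  simp only [sub_e0_sub_stepVec_w0] at h2
  have h3 : (∑ w, srwI 11 n l (z - e0 - SRW.stepVec w)) = 22 * srwI 11 n (l + 1) (z - e0) := by
    rw [h1]; push_cast; ring
  linarith

/-- **One-step soundness**: if `look` encloses on `n = 2..4`, `l ≤ L`, then `stepEnc look` encloses on `l + 1 ≤ L`.
[cite: FitznerVanDerHofstad2016NoBLE, (3.34)–(3.35) p. 1071] -/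
theorem stepEnc_sound {look : ℕ → ℕ → (Fin 11 → ℤ) → Option (ℚ × ℚ)} {L : ℕ}
    (hlook : ∀ (n l : ℕ) (y : Fin 11 → ℤ) (p : ℚ × ℚ), 2 ≤ n → n ≤ 4 → l ≤ L → look n l y = some p →
      ((p.1 : ℚ) : ℝ) ≤ srwI 11 n l y ∧ srwI 11 n l y ≤ ((p.2 : ℚ) : ℝ))
    {n l : ℕ} {z : Fin 11 → ℤ} {p : ℚ × ℚ} (hn2 : 2 ≤ n) (hn : n ≤ 4) (hl : l + 1 ≤ L)
    (h : stepEnc look n l z = some p) : ((p.1 : ℚ) : ℝ) ≤ srwI 11 n l z ∧ srwI 11 n l z ≤ ((p.2 : ℚ) : ℝ) := by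
  unfold stepEnc at h
  by_cases hc : (look n (l + 1) (z - e0)).isSome = true ∧
      ∀ w ∈ dirsRest, (look n l (z - e0 - SRW.stepVec w)).isSome = true
  · rw [if_pos hc, Option.some.injEq] at h
    subst h
    obtain ⟨hcs, hnb⟩ := hc
    obtain ⟨c, hc'⟩ := Option.isSome_iff_exists.mp hcs
    have IHc := hlook n (l + 1) (z - e0) c hn2 hn hl hc'
    have IHw : ∀ w ∈ dirsRest,
        ((loOf (look n l (z - e0 - SRW.stepVec w)) : ℚ) : ℝ) ≤ srwI 11 n l (z - e0 - SRW.stepVec w) ∧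
        srwI 11 n l (z - e0 - SRW.stepVec w) ≤ ((hiOf (look n l (z - e0 - SRW.stepVec w)) : ℚ) : ℝ) := by
      intro w hw
      obtain ⟨q, hq⟩ := Option.isSome_iff_exists.mp (hnb w hw)
      have H := hlook n l (z - e0 - SRW.stepVec w) q hn2 hn (by omega) hq
      simp only [loOf, hiOf, hq, Option.getD_some]
      exact H
    have eLo : loOf (look n (l + 1) (z - e0)) = c.1 := by simp only [loOf, hc', Option.getD_some]
    have eHi : hiOf (look n (l + 1) (z - e0)) = c.2 := by simp only [hiOf, hc', Option.getD_some]
    have memF : ∀ w, w ∈ Finset.univ.erase w0 → w ∈ dirsRest := fun w hw => by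
      rw [← dirsRest_toFinset] at hw; exact List.mem_toFinset.mp hw
    have sHi : (∑ w ∈ Finset.univ.erase w0, srwI 11 n l (z - e0 - SRW.stepVec w))
        ≤ ∑ w ∈ Finset.univ.erase w0, ((hiOf (look n l (z - e0 - SRW.stepVec w)) : ℚ) : ℝ) :=
      Finset.sum_le_sum fun w hw => (IHw w (memF w hw)).2
    have sLo : (∑ w ∈ Finset.univ.erase w0, ((loOf (look n l (z - e0 - SRW.stepVec w)) : ℚ) : ℝ))
        ≤ ∑ w ∈ Finset.univ.erase w0, srwI 11 n l (z - e0 - SRW.stepVec w) :=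
      Finset.sum_le_sum fun w hw => (IHw w (memF w hw)).1
    rw [srwI_eq_oneStep hn l z]
    simp only [eLo, eHi, sum_dirsRest]
    push_cast
    constructor <;> linarith [IHc.1, IHc.2, sHi, sLo]
  · rw [if_neg hc] at h
    exact absurd h (by simp)

/-- **Tiered enclosure** `[lo, hi] ∋ I_{n,l}(z; 11)`: the tables if `z` is tabulated; else, if `z` lies in a derived
class `c` (and fuel permits), the one-step enclosure at the literal representative `Z.pt c` over tiered enclosures of
smaller fuel. [cite: FitznerVanDerHofstad2016NoBLE, (3.34)–(3.35) p. 1071, (5.1) p. 1090] -/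
def encF : ℕ → ℕ → ℕ → (Fin 11 → ℤ) → Option (ℚ × ℚ)
  | 0, n, l, z => enc1 n l z
  | f + 1, n, l, z =>
    match enc1 n l z with
    | some p => some p
    | none =>
      match matchZ (absKey z) with
      | some c => stepEnc (encF f) n l (Z.pt c)
      | none => none

/-- **Tiered soundness** (`n = 2..4`, `l + fuel ≤ 28`). [cite: FitznerVanDerHofstad2016NoBLE, (3.35), (5.1)] -/
theorem encF_sound (hBY : SeedBallsY) : ∀ (f n l : ℕ) (z : Fin 11 → ℤ) (p : ℚ × ℚ), 2 ≤ n → n ≤ 4 → l + f ≤ 28 →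
    encF f n l z = some p → ((p.1 : ℚ) : ℝ) ≤ srwI 11 n l z ∧ srwI 11 n l z ≤ ((p.2 : ℚ) : ℝ)
  | 0, n, l, z, p, hn2, hn, hl, h => enc1_sound hBY hn2 hn (by omega) h
  | f + 1, n, l, z, p, hn2, hn, hl, h => by
    rw [encF] at h
    cases h1 : enc1 n l z with
    | some q =>
      simp only [h1, Option.some.injEq] at h
      subst h
      exact enc1_sound hBY hn2 hn (by omega) h1
    | none =>
      simp only [h1] at h
      cases hZ : matchZ (absKey z) with
      | some c =>
        simp only [hZ] at h
        obtain ⟨hm, hk⟩ := matchZ_spec hZ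
        rw [srwI_eq_of_absKey_eq (show absKey z = absKey (Z.pt c) by rw [← hk]; exact kZ_eq c hm)]
        exact stepEnc_sound (L := 28 - f)
          (fun n' l' y q hn2' hn' hl' hq => encF_sound hBY f n' l' y q hn2' hn' (by omega) hq) hn2 hn (by omega) h
      | none =>
        simp only [hZ] at h
        exact absurd h (by simp)

/-- The enclosure used by the evaluators: fuel `2`. [cite: FitznerVanDerHofstad2016NoBLE, (3.34)–(3.35) p. 1071, (5.1) p. 1090] -/
def encT (n l : ℕ) (z : Fin 11 → ℤ) : Option (ℚ × ℚ) := encF 2 n l z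

/-- Soundness of `encT` (`n = 2..4`, `l ≤ 26`). [cite: FitznerVanDerHofstad2016NoBLE, (3.35), (5.1)] -/
theorem encT_sound (hBY : SeedBallsY) {n l : ℕ} {z : Fin 11 → ℤ} {p : ℚ × ℚ} (hn2 : 2 ≤ n) (hn : n ≤ 4)
    (hl : l ≤ 26) (h : encT n l z = some p) :
    ((p.1 : ℚ) : ℝ) ≤ srwI 11 n l z ∧ srwI 11 n l z ≤ ((p.2 : ℚ) : ℝ) :=
  encF_sound hBY 2 n l z p hn2 hn (by omega) h

/-- From definedness to the endpoints `loOf/hiOf`. [cite: FitznerVanDerHofstad2016NoBLE, (3.35) p. 1071, (5.1) p. 1090] -/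
theorem encT_bounds (hBY : SeedBallsY) {n l : ℕ} {z : Fin 11 → ℤ} (hn2 : 2 ≤ n) (hn : n ≤ 4) (hl : l ≤ 26)
    (h : (encT n l z).isSome = true) :
    ((loOf (encT n l z) : ℚ) : ℝ) ≤ srwI 11 n l z ∧ srwI 11 n l z ≤ ((hiOf (encT n l z) : ℚ) : ℝ) := by
  obtain ⟨p, hp⟩ := Option.isSome_iff_exists.mp h
  have H := encT_sound hBY hn2 hn hl hp
  simp only [loOf, hiOf, hp, Option.getD_some]
  exact H

/-! ### D. The evaluators of `srwJ` and `srwJcone` -/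

/-- Definedness of all enclosures read by `jUp/jLo m l z`. [cite: FitznerVanDerHofstad2016NoBLE, (1.6.9) p. 1058] -/
def okJ (m l : ℕ) (z : Fin 11 → ℤ) : Prop :=
  (encT m (l + 1) z).isSome = true ∧ (encT (m + 1) l z).isSome = true ∧
    ∀ ι ∈ fin11, (encT (m + 1) l (z + axisVec ι 2)).isSome = true ∧ (encT (m + 1) l (z - axisVec ι 2)).isSome = true

/-- UPPER evaluator of `𝓙 = srwJ 11 m l z` (term by term on (1.6.9)). [cite: FitznerVanDerHofstad2016NoBLE, (1.6.9) p. 1058] -/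
def jUp (m l : ℕ) (z : Fin 11 → ℤ) : ℚ :=
  hiOf (encT m (l + 1) z) - loOf (encT (m + 1) l z) / 11
    + (fin11.map fun ι => hiOf (encT (m + 1) l (z + axisVec ι 2)) + hiOf (encT (m + 1) l (z - axisVec ι 2))).sum / 242

/-- LOWER evaluator of `𝓙 = srwJ 11 m l z`. [cite: FitznerVanDerHofstad2016NoBLE, (1.6.9) p. 1058] -/
def jLo (m l : ℕ) (z : Fin 11 → ℤ) : ℚ :=
  loOf (encT m (l + 1) z) - hiOf (encT (m + 1) l z) / 11
    + (fin11.map fun ι => loOf (encT (m + 1) l (z + axisVec ι 2)) + loOf (encT (m + 1) l (z - axisVec ι 2))).sum / 242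

/-- **`srwJ ≤ jUp`** (`m = 2, 3`, `l ≤ 25`). [cite: FitznerVanDerHofstad2016NoBLE, (1.6.9) p. 1058, (3.30) p. 1070] -/
theorem srwJ_le_jUp (hBY : SeedBallsY) {m l : ℕ} {z : Fin 11 → ℤ} (hm2 : 2 ≤ m) (hm : m ≤ 3) (hl : l ≤ 25)
    (hok : okJ m l z) : srwJ 11 m l z ≤ ((jUp m l z : ℚ) : ℝ) := by
  obtain ⟨h1, h2, h3⟩ := hok
  have Ha := (encT_bounds hBY hm2 (by omega) (by omega) h1).2
  have Hb := (encT_bounds hBY (show 2 ≤ m + 1 by omega) (by omega) (by omega) h2).1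
  have Hs : (∑ ι : Fin 11, (srwI 11 (m + 1) l (z + axisVec ι 2) + srwI 11 (m + 1) l (z - axisVec ι 2)))
      ≤ ∑ ι : Fin 11, (((hiOf (encT (m + 1) l (z + axisVec ι 2)) : ℚ) : ℝ)
          + ((hiOf (encT (m + 1) l (z - axisVec ι 2)) : ℚ) : ℝ)) := by
    refine Finset.sum_le_sum fun ι _ => ?_
    have hι : ι ∈ fin11 := by rw [← List.mem_toFinset, fin11_toFinset]; exact Finset.mem_univ ι
    exact add_le_add (encT_bounds hBY (show 2 ≤ m + 1 by omega) (by omega) (by omega) (h3 ι hι).1).2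
      (encT_bounds hBY (show 2 ≤ m + 1 by omega) (by omega) (by omega) (h3 ι hι).2).2
  have step : srwJ 11 m l z ≤ ((hiOf (encT m (l + 1) z) : ℚ) : ℝ) - ((loOf (encT (m + 1) l z) : ℚ) : ℝ) / 11
      + (∑ ι : Fin 11, (((hiOf (encT (m + 1) l (z + axisVec ι 2)) : ℚ) : ℝ)
          + ((hiOf (encT (m + 1) l (z - axisVec ι 2)) : ℚ) : ℝ))) / 242 := by
    rw [srwJ_def]; push_cast
    have e1 : srwI 11 (m + 1) l z / (11 : ℝ) ≥ ((loOf (encT (m + 1) l z) : ℚ) : ℝ) / 11 := by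
      gcongr
    have e2 : (∑ ι : Fin 11, (srwI 11 (m + 1) l (z + axisVec ι 2) + srwI 11 (m + 1) l (z - axisVec ι 2)))
        / (2 * (11 : ℝ) ^ 2) ≤ (∑ ι : Fin 11, (((hiOf (encT (m + 1) l (z + axisVec ι 2)) : ℚ) : ℝ)
          + ((hiOf (encT (m + 1) l (z - axisVec ι 2)) : ℚ) : ℝ))) / 242 := by
      rw [show (2 * (11 : ℝ) ^ 2) = 242 by norm_num]; gcongr
    linarith
  refine le_trans step (le_of_eq ?_)
  unfold jUp
  rw [sum_fin11]
  push_cast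
  ring

/-- **`jLo ≤ srwJ`** (`m = 2, 3`, `l ≤ 25`). [cite: FitznerVanDerHofstad2016NoBLE, (1.6.9) p. 1058, (3.30) p. 1070] -/
theorem jLo_le_srwJ (hBY : SeedBallsY) {m l : ℕ} {z : Fin 11 → ℤ} (hm2 : 2 ≤ m) (hm : m ≤ 3) (hl : l ≤ 25)
    (hok : okJ m l z) : ((jLo m l z : ℚ) : ℝ) ≤ srwJ 11 m l z := by
  obtain ⟨h1, h2, h3⟩ := hok
  have Ha := (encT_bounds hBY hm2 (by omega) (by omega) h1).1
  have Hb := (encT_bounds hBY (show 2 ≤ m + 1 by omega) (by omega) (by omega) h2).2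
  have Hs : (∑ ι : Fin 11, (((loOf (encT (m + 1) l (z + axisVec ι 2)) : ℚ) : ℝ)
          + ((loOf (encT (m + 1) l (z - axisVec ι 2)) : ℚ) : ℝ)))
      ≤ ∑ ι : Fin 11, (srwI 11 (m + 1) l (z + axisVec ι 2) + srwI 11 (m + 1) l (z - axisVec ι 2)) := by
    refine Finset.sum_le_sum fun ι _ => ?_
    have hι : ι ∈ fin11 := by rw [← List.mem_toFinset, fin11_toFinset]; exact Finset.mem_univ ι
    exact add_le_add (encT_bounds hBY (show 2 ≤ m + 1 by omega) (by omega) (by omega) (h3 ι hι).1).1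
      (encT_bounds hBY (show 2 ≤ m + 1 by omega) (by omega) (by omega) (h3 ι hι).2).1
  have step : ((loOf (encT m (l + 1) z) : ℚ) : ℝ) - ((hiOf (encT (m + 1) l z) : ℚ) : ℝ) / 11
      + (∑ ι : Fin 11, (((loOf (encT (m + 1) l (z + axisVec ι 2)) : ℚ) : ℝ)
          + ((loOf (encT (m + 1) l (z - axisVec ι 2)) : ℚ) : ℝ))) / 242 ≤ srwJ 11 m l z := by
    rw [srwJ_def]; push_cast
    have e1 : srwI 11 (m + 1) l z / (11 : ℝ) ≤ ((hiOf (encT (m + 1) l z) : ℚ) : ℝ) / 11 := by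
      gcongr
    have e2 : (∑ ι : Fin 11, (((loOf (encT (m + 1) l (z + axisVec ι 2)) : ℚ) : ℝ)
          + ((loOf (encT (m + 1) l (z - axisVec ι 2)) : ℚ) : ℝ))) / 242
        ≤ (∑ ι : Fin 11, (srwI 11 (m + 1) l (z + axisVec ι 2) + srwI 11 (m + 1) l (z - axisVec ι 2)))
          / (2 * (11 : ℝ) ^ 2) := by
      rw [show (2 * (11 : ℝ) ^ 2) = 242 by norm_num]; gcongr
    linarith
  refine le_trans (le_of_eq ?_) step
  unfold jLo
  rw [sum_fin11]
  push_cast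
  ring

/-- Definedness of all enclosures read by `coneUp m l w`. [cite: FitznerVanDerHofstad2016NoBLE, (1.6.9) p. 1058, (3.30) p. 1070] -/
def okC (m l : ℕ) (w : Fin 11 → ℤ) : Prop :=
  (encT m (l + 1) w).isSome = true ∧
    ∀ j ∈ fin11, (encT (m + 1) l (Function.update w j (max (w j - 2) 0))).isSome = true

/-- UPPER evaluator of the cone majorant `srwJcone 11 m l w`. [cite: FitznerVanDerHofstad2016NoBLE, (1.6.9) p. 1058, (3.30) p. 1070] -/
def coneUp (m l : ℕ) (w : Fin 11 → ℤ) : ℚ :=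
  hiOf (encT m (l + 1) w)
    + (fin11.map fun j => hiOf (encT (m + 1) l (Function.update w j (max (w j - 2) 0)))).sum / 242

/-- **`srwJcone ≤ coneUp`** (`m = 2, 3`, `l ≤ 25`). [cite: FitznerVanDerHofstad2016NoBLE, (1.6.9) p. 1058, (3.30) p. 1070] -/
theorem srwJcone_le_coneUp (hBY : SeedBallsY) {m l : ℕ} {w : Fin 11 → ℤ} (hm2 : 2 ≤ m) (hm : m ≤ 3) (hl : l ≤ 25)
    (hok : okC m l w) : srwJcone 11 m l w ≤ ((coneUp m l w : ℚ) : ℝ) := by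
  obtain ⟨h1, h3⟩ := hok
  have Ha := (encT_bounds hBY hm2 (by omega) (by omega) h1).2
  have Hs : (∑ j : Fin 11, srwI 11 (m + 1) l (Function.update w j (max (w j - 2) 0)))
      ≤ ∑ j : Fin 11, (((hiOf (encT (m + 1) l (Function.update w j (max (w j - 2) 0)))) : ℚ) : ℝ) := by
    refine Finset.sum_le_sum fun j _ => ?_
    have hj : j ∈ fin11 := by rw [← List.mem_toFinset, fin11_toFinset]; exact Finset.mem_univ j
    exact (encT_bounds hBY (show 2 ≤ m + 1 by omega) (by omega) (by omega) (h3 j hj)).2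
  have step : srwJcone 11 m l w ≤ ((hiOf (encT m (l + 1) w) : ℚ) : ℝ)
      + (∑ j : Fin 11, (((hiOf (encT (m + 1) l (Function.update w j (max (w j - 2) 0)))) : ℚ) : ℝ)) / 242 := by
    rw [srwJcone]; push_cast
    have e2 : (∑ j : Fin 11, srwI 11 (m + 1) l (Function.update w j (max (w j - 2) 0))) / (2 * (11 : ℝ) ^ 2)
        ≤ (∑ j : Fin 11, (((hiOf (encT (m + 1) l (Function.update w j (max (w j - 2) 0)))) : ℚ) : ℝ)) / 242 := by
      rw [show (2 * (11 : ℝ) ^ 2) = 242 by norm_num]; gcongr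
    linarith
  refine le_trans step (le_of_eq ?_)
  unfold coneUp
  rw [sum_fin11]
  push_cast
  ring

/-! ### E. The decidable mirrors of `JUpper` / `JLower` -/

/-- Decidable mirror of `JUpper 11 m l s R T`: every enclosure defined and `jUp ≤ T p` (rows `s ≤ r ≤ R`),
`coneUp ≤ T p` (row `R + 1`). [cite: FitznerVanDerHofstad2016NoBLE, (1.6.9) p. 1058] -/
def JUpperQ (m l s R : ℕ) (T : List ℕ → ℚ) : Prop :=
  (∀ r : ℕ, s ≤ r → r ≤ R → ∀ p ∈ partsLe r r r, okJ m l (vecOfParts 11 p) ∧ jUp m l (vecOfParts 11 p) ≤ T p) ∧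
  (∀ p ∈ partsLe (R + 1) (R + 1) (R + 1), okC m l (vecOfParts 11 p) ∧ coneUp m l (vecOfParts 11 p) ≤ T p)

/-- `JUpperQ` is decidable. [cite: FitznerVanDerHofstad2016NoBLE, (1.6.9) p. 1058] -/
instance (m l s R : ℕ) (T : List ℕ → ℚ) : Decidable (JUpperQ m l s R T) := by
  unfold JUpperQ okJ okC; infer_instance

/-- Decidable mirror of `JLower 11 m l L nodes`: every enclosure defined and `L v ≤ jLo` at the nodes. [cite: FitznerVanDerHofstad2016NoBLE, (1.6.9) p. 1058] -/
def JLowerQ (m l : ℕ) (L : List ℕ → ℚ) (nodes : List (List ℕ)) : Prop :=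
  ∀ v ∈ nodes, okJ m l (vecOfParts 11 v) ∧ L v ≤ jLo m l (vecOfParts 11 v)

/-- `JLowerQ` is decidable. [cite: FitznerVanDerHofstad2016NoBLE, (1.6.9) p. 1058] -/
instance (m l : ℕ) (L : List ℕ → ℚ) (nodes : List (List ℕ)) : Decidable (JLowerQ m l L nodes) := by
  unfold JLowerQ okJ; infer_instance

/-- **Bridge, upper**: `JUpperQ ⇒ JUpper` (`m = 2, 3`, `l ≤ 25`). [cite: FitznerVanDerHofstad2016NoBLE, (1.6.9), (3.30)] -/
theorem jUpper_of_Q (hBY : SeedBallsY) {m l s R : ℕ} {T : List ℕ → ℚ} (hm2 : 2 ≤ m) (hm : m ≤ 3) (hl : l ≤ 25)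
    (h : JUpperQ m l s R T) : JUpper 11 m l s R T := by
  obtain ⟨hA, hB⟩ := h
  unfold JUpper
  refine ⟨fun r hs hr p hp => ?_, fun p hp => ?_⟩
  · obtain ⟨hok, hle⟩ := hA r hs hr p hp
    exact le_trans (srwJ_le_jUp hBY hm2 hm hl hok) (by exact_mod_cast hle)
  · obtain ⟨hok, hle⟩ := hB p hp
    exact le_trans (srwJcone_le_coneUp hBY hm2 hm hl hok) (by exact_mod_cast hle)

/-- **Bridge, lower**: `JLowerQ ⇒ JLower` (`m = 2, 3`, `l ≤ 25`). [cite: FitznerVanDerHofstad2016NoBLE, (1.6.9), (3.30)] -/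
theorem jLower_of_Q (hBY : SeedBallsY) {m l : ℕ} {L : List ℕ → ℚ} {nodes : List (List ℕ)} (hm2 : 2 ≤ m) (hm : m ≤ 3)
    (hl : l ≤ 25) (h : JLowerQ m l L nodes) : JLower 11 m l L nodes := by
  unfold JLower
  intro v hv
  obtain ⟨hok, hle⟩ := h v hv
  exact le_trans (by exact_mod_cast hle) (jLo_le_srwJ hBY hm2 hm hl hok)

end CertD11

end Stage1Cells

end Literature.Probability.FitznerVanDerHofstad2017
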